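import Summits.Ventures.CertifiedManyBodySolver.Downfold.EmeryAxialSlabBi2223IPWindows
import Summits.Ventures.CertifiedManyBodySolver.Downfold.EmeryFermiFillingBi2223IP
import Summits.Ventures.CertifiedManyBodySolver.Downfold.EmeryFermiFillingLa214
import Summits.Ventures.CertifiedManyBodySolver.Downfold.EmeryAxialConductionBand
import HarnessLib

/-!
# Bi₂Sr₂Ca₂Cu₃O₁₀ INNER plane (box #307 Bi-2223, (K) source rows): the axial co-shift census ON THE TYPED BOX `emeryBoxBi2223IPK11Src` — verdicts against the object-E row
# `t′/t ∈ [-0.437, -0.336]` and their FOUR-ORBITAL reading (companion of `EmeryAxialSlabBi2223IPWindows`, which carries the method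
# docstring, the slab table and the raw slab windows; the kernel certificates are in `EmeryAxialSlabBi2223IPSubs*`)

Venture CertifiedManyBodySolver, cell `pub/hubbard-downfold` (stage S1), seat hubbard-downfold-mod-4 (technique B); namespace
`Summit.Ventures.CertifiedManyBodySolver.Downfold.Emery`. Everything PROVED. READING (certified): `a ∈ [0, 0.02]` ⇒ the co-shifted Fermi surface is STILL LESS cuprate-like than the E row (`t′/t > -0.336`): the REQUIRED axial admixture at the Fermi level is `a_F > 0.02` eV (`emeryBoxBi2223IPK11Src_axial_short`); `a ∈ [0.3, 0.35]` ⇒ the co-shifted window lies INSIDE the E row (`emeryBoxBi2223IPK11Src_axial_inside`).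
WHAT THIS IS NOT: not a statement that the material's parameters ARE in the box (SCREENING-GRADE provenance); `U = 0` band kinematics; no phase
sentence; the E row is a [float] literature refit; `a_F` is the ADDITIONAL admixture beyond the box's σ rows (a model-form distance).
Sources: [AndersenEtAl1995, §§5–6]; [PavariniEtAl2001, Eqs. (1)–(3), Fig. 3]; [HybertsenSchluterChristensen1989, Eq. (1)].
-/

noncomputable section

namespace Summit.Ventures.CertifiedManyBodySolver.Downfold.Emery

open Real Set
open Summit.Ventures.CertifiedManyBodySolver.Downfold

/-! ## §2 The typed box and the co-shift as a parameter -/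

/-- The one-body rows and the per-spin filling of `emeryBoxBi2223IPK11Src` read by this file. [folklore] -/
theorem emeryBoxBi2223IPK11Src_axRows {p : EmeryCoord → ℝ} (hp : emeryBoxBi2223IPK11Src.Mem p) :
    p .DeltaPd ∈ Set.Icc (103 / 50 : ℝ) (133 / 50 : ℝ) ∧ p .tpd ∈ Set.Icc (59 / 50 : ℝ) (139 / 100 : ℝ) ∧
      p .tpp ∈ Set.Icc (31 / 50 : ℝ) (73 / 100 : ℝ) ∧ p .tppP ∈ Set.Icc (3 / 20 : ℝ) (9 / 50 : ℝ) ∧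
      (2 - p .nHoles) / 2 ∈ Set.Icc (803 / 2000 : ℝ) (211 / 500 : ℝ) := by
  obtain ⟨hΔ, ha, hb, hc, hn⟩ := emeryBoxBi2223IPK11Src_mem_rows hp
  exact ⟨hΔ, ha, hb, hc, abFilling_rowBi2223OP_of_nHoles hn.1 hn.2 rfl⟩

/-- **Slab 0 on the typed box**: for every parameter vector of `emeryBoxBi2223IPK11Src`, every co-shift `a ∈ [0, 0.02]` and every Fermi energy at
which the CO-SHIFTED σ antibonding band holds the box's electrons: `ε ∈ [1.1, 2.04]`, `t′/t ∈ [-0.3233, -0.2457]` (SHORT).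
[folklore] -/
theorem emeryBoxBi2223IPK11Src_axSlab0 :
    HoldsOn (fun p : EmeryCoord → ℝ => ∀ a ε : ℝ, a ∈ Set.Icc (0 : ℝ) (1 / 50 : ℝ) →
      abFilling (p .DeltaPd) (p .tpd) (p .tpp + a) (p .tppP + a) ε = (2 - p .nHoles) / 2 →
      ε ∈ Set.Icc (11 / 10 : ℝ) (51 / 25 : ℝ) ∧
      fsRatio (p .DeltaPd) (p .tpd) (p .tpp + a) (p .tppP + a) ε ∈ Set.Icc (-(3233 / 10000 : ℝ)) (-(2457 / 10000 : ℝ))) emeryBoxBi2223IPK11Src := by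
  intro p hp a ε ha' hf
  obtain ⟨hΔ, ha, hb, hc, hν⟩ := emeryBoxBi2223IPK11Src_axRows hp
  rw [← hf] at hν
  exact bi2223IPAxSlab0_window hΔ ha ⟨by linarith [hb.1, ha'.1], by linarith [hb.2, ha'.2]⟩
    ⟨by linarith [hc.1, ha'.1], by linarith [hc.2, ha'.2]⟩ hν

/-- **Slab 1 on the typed box**: for every parameter vector of `emeryBoxBi2223IPK11Src`, every co-shift `a ∈ [0.02, 0.05]` and every Fermi energy at
which the CO-SHIFTED σ antibonding band holds the box's electrons: `ε ∈ [1.08, 2.04]`, `t′/t ∈ [-0.3362, -0.2549]` (MEETS).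
[folklore] -/
theorem emeryBoxBi2223IPK11Src_axSlab1 :
    HoldsOn (fun p : EmeryCoord → ℝ => ∀ a ε : ℝ, a ∈ Set.Icc (1 / 50 : ℝ) (1 / 20 : ℝ) →
      abFilling (p .DeltaPd) (p .tpd) (p .tpp + a) (p .tppP + a) ε = (2 - p .nHoles) / 2 →
      ε ∈ Set.Icc (27 / 25 : ℝ) (51 / 25 : ℝ) ∧
      fsRatio (p .DeltaPd) (p .tpd) (p .tpp + a) (p .tppP + a) ε ∈ Set.Icc (-(1681 / 5000 : ℝ)) (-(2549 / 10000 : ℝ))) emeryBoxBi2223IPK11Src := by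
  intro p hp a ε ha' hf
  obtain ⟨hΔ, ha, hb, hc, hν⟩ := emeryBoxBi2223IPK11Src_axRows hp
  rw [← hf] at hν
  exact bi2223IPAxSlab1_window hΔ ha ⟨by linarith [hb.1, ha'.1], by linarith [hb.2, ha'.2]⟩
    ⟨by linarith [hc.1, ha'.1], by linarith [hc.2, ha'.2]⟩ hν

/-- **Slab 2 on the typed box**: for every parameter vector of `emeryBoxBi2223IPK11Src`, every co-shift `a ∈ [0.05, 0.1]` and every Fermi energy at
which the CO-SHIFTED σ antibonding band holds the box's electrons: `ε ∈ [1.06, 2.02]`, `t′/t ∈ [-0.3569, -0.2682]` (MEETS).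
[folklore] -/
theorem emeryBoxBi2223IPK11Src_axSlab2 :
    HoldsOn (fun p : EmeryCoord → ℝ => ∀ a ε : ℝ, a ∈ Set.Icc (1 / 20 : ℝ) (1 / 10 : ℝ) →
      abFilling (p .DeltaPd) (p .tpd) (p .tpp + a) (p .tppP + a) ε = (2 - p .nHoles) / 2 →
      ε ∈ Set.Icc (53 / 50 : ℝ) (101 / 50 : ℝ) ∧
      fsRatio (p .DeltaPd) (p .tpd) (p .tpp + a) (p .tppP + a) ε ∈ Set.Icc (-(3569 / 10000 : ℝ)) (-(1341 / 5000 : ℝ))) emeryBoxBi2223IPK11Src := by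
  intro p hp a ε ha' hf
  obtain ⟨hΔ, ha, hb, hc, hν⟩ := emeryBoxBi2223IPK11Src_axRows hp
  rw [← hf] at hν
  exact bi2223IPAxSlab2_window hΔ ha ⟨by linarith [hb.1, ha'.1], by linarith [hb.2, ha'.2]⟩
    ⟨by linarith [hc.1, ha'.1], by linarith [hc.2, ha'.2]⟩ hν

/-- **Slab 3 on the typed box**: for every parameter vector of `emeryBoxBi2223IPK11Src`, every co-shift `a ∈ [0.1, 0.2]` and every Fermi energy at
which the CO-SHIFTED σ antibonding band holds the box's electrons: `ε ∈ [1.0, 2.02]`, `t′/t ∈ [-0.3943, -0.2869]` (MEETS).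
[folklore] -/
theorem emeryBoxBi2223IPK11Src_axSlab3 :
    HoldsOn (fun p : EmeryCoord → ℝ => ∀ a ε : ℝ, a ∈ Set.Icc (1 / 10 : ℝ) (1 / 5 : ℝ) →
      abFilling (p .DeltaPd) (p .tpd) (p .tpp + a) (p .tppP + a) ε = (2 - p .nHoles) / 2 →
      ε ∈ Set.Icc (1 : ℝ) (101 / 50 : ℝ) ∧
      fsRatio (p .DeltaPd) (p .tpd) (p .tpp + a) (p .tppP + a) ε ∈ Set.Icc (-(3943 / 10000 : ℝ)) (-(2869 / 10000 : ℝ))) emeryBoxBi2223IPK11Src := by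
  intro p hp a ε ha' hf
  obtain ⟨hΔ, ha, hb, hc, hν⟩ := emeryBoxBi2223IPK11Src_axRows hp
  rw [← hf] at hν
  exact bi2223IPAxSlab3_window hΔ ha ⟨by linarith [hb.1, ha'.1], by linarith [hb.2, ha'.2]⟩
    ⟨by linarith [hc.1, ha'.1], by linarith [hc.2, ha'.2]⟩ hν

/-- **Slab 4 on the typed box**: for every parameter vector of `emeryBoxBi2223IPK11Src`, every co-shift `a ∈ [0.2, 0.25]` and every Fermi energy at
which the CO-SHIFTED σ antibonding band holds the box's electrons: `ε ∈ [1.0, 1.94]`, `t′/t ∈ [-0.4068, -0.3179]` (MEETS).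
[folklore] -/
theorem emeryBoxBi2223IPK11Src_axSlab4 :
    HoldsOn (fun p : EmeryCoord → ℝ => ∀ a ε : ℝ, a ∈ Set.Icc (1 / 5 : ℝ) (1 / 4 : ℝ) →
      abFilling (p .DeltaPd) (p .tpd) (p .tpp + a) (p .tppP + a) ε = (2 - p .nHoles) / 2 →
      ε ∈ Set.Icc (1 : ℝ) (97 / 50 : ℝ) ∧
      fsRatio (p .DeltaPd) (p .tpd) (p .tpp + a) (p .tppP + a) ε ∈ Set.Icc (-(1017 / 2500 : ℝ)) (-(3179 / 10000 : ℝ))) emeryBoxBi2223IPK11Src := by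
  intro p hp a ε ha' hf
  obtain ⟨hΔ, ha, hb, hc, hν⟩ := emeryBoxBi2223IPK11Src_axRows hp
  rw [← hf] at hν
  exact bi2223IPAxSlab4_window hΔ ha ⟨by linarith [hb.1, ha'.1], by linarith [hb.2, ha'.2]⟩
    ⟨by linarith [hc.1, ha'.1], by linarith [hc.2, ha'.2]⟩ hν

/-- **Slab 5 on the typed box**: for every parameter vector of `emeryBoxBi2223IPK11Src`, every co-shift `a ∈ [0.25, 0.3]` and every Fermi energy at
which the CO-SHIFTED σ antibonding band holds the box's electrons: `ε ∈ [0.98, 1.92]`, `t′/t ∈ [-0.4209, -0.3316]` (MEETS).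
[folklore] -/
theorem emeryBoxBi2223IPK11Src_axSlab5 :
    HoldsOn (fun p : EmeryCoord → ℝ => ∀ a ε : ℝ, a ∈ Set.Icc (1 / 4 : ℝ) (3 / 10 : ℝ) →
      abFilling (p .DeltaPd) (p .tpd) (p .tpp + a) (p .tppP + a) ε = (2 - p .nHoles) / 2 →
      ε ∈ Set.Icc (49 / 50 : ℝ) (48 / 25 : ℝ) ∧
      fsRatio (p .DeltaPd) (p .tpd) (p .tpp + a) (p .tppP + a) ε ∈ Set.Icc (-(4209 / 10000 : ℝ)) (-(829 / 2500 : ℝ))) emeryBoxBi2223IPK11Src := by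
  intro p hp a ε ha' hf
  obtain ⟨hΔ, ha, hb, hc, hν⟩ := emeryBoxBi2223IPK11Src_axRows hp
  rw [← hf] at hν
  exact bi2223IPAxSlab5_window hΔ ha ⟨by linarith [hb.1, ha'.1], by linarith [hb.2, ha'.2]⟩
    ⟨by linarith [hc.1, ha'.1], by linarith [hc.2, ha'.2]⟩ hν

/-- **Slab 6 on the typed box**: for every parameter vector of `emeryBoxBi2223IPK11Src`, every co-shift `a ∈ [0.3, 0.35]` and every Fermi energy at
which the CO-SHIFTED σ antibonding band holds the box's electrons: `ε ∈ [0.98, 1.88]`, `t′/t ∈ [-0.4339, -0.3439]` (INSIDE).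
[folklore] -/
theorem emeryBoxBi2223IPK11Src_axSlab6 :
    HoldsOn (fun p : EmeryCoord → ℝ => ∀ a ε : ℝ, a ∈ Set.Icc (3 / 10 : ℝ) (7 / 20 : ℝ) →
      abFilling (p .DeltaPd) (p .tpd) (p .tpp + a) (p .tppP + a) ε = (2 - p .nHoles) / 2 →
      ε ∈ Set.Icc (49 / 50 : ℝ) (47 / 25 : ℝ) ∧
      fsRatio (p .DeltaPd) (p .tpd) (p .tpp + a) (p .tppP + a) ε ∈ Set.Icc (-(4339 / 10000 : ℝ)) (-(3439 / 10000 : ℝ))) emeryBoxBi2223IPK11Src := by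
  intro p hp a ε ha' hf
  obtain ⟨hΔ, ha, hb, hc, hν⟩ := emeryBoxBi2223IPK11Src_axRows hp
  rw [← hf] at hν
  exact bi2223IPAxSlab6_window hΔ ha ⟨by linarith [hb.1, ha'.1], by linarith [hb.2, ha'.2]⟩
    ⟨by linarith [hc.1, ha'.1], by linarith [hc.2, ha'.2]⟩ hν

/-- **Slab 7 on the typed box**: for every parameter vector of `emeryBoxBi2223IPK11Src`, every co-shift `a ∈ [0.35, 0.4]` and every Fermi energy at
which the CO-SHIFTED σ antibonding band holds the box's electrons: `ε ∈ [0.96, 1.86]`, `t′/t ∈ [-0.4457, -0.3551]` (MEETS).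
[folklore] -/
theorem emeryBoxBi2223IPK11Src_axSlab7 :
    HoldsOn (fun p : EmeryCoord → ℝ => ∀ a ε : ℝ, a ∈ Set.Icc (7 / 20 : ℝ) (2 / 5 : ℝ) →
      abFilling (p .DeltaPd) (p .tpd) (p .tpp + a) (p .tppP + a) ε = (2 - p .nHoles) / 2 →
      ε ∈ Set.Icc (24 / 25 : ℝ) (93 / 50 : ℝ) ∧
      fsRatio (p .DeltaPd) (p .tpd) (p .tpp + a) (p .tppP + a) ε ∈ Set.Icc (-(4457 / 10000 : ℝ)) (-(3551 / 10000 : ℝ))) emeryBoxBi2223IPK11Src := by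
  intro p hp a ε ha' hf
  obtain ⟨hΔ, ha, hb, hc, hν⟩ := emeryBoxBi2223IPK11Src_axRows hp
  rw [← hf] at hν
  exact bi2223IPAxSlab7_window hΔ ha ⟨by linarith [hb.1, ha'.1], by linarith [hb.2, ha'.2]⟩
    ⟨by linarith [hc.1, ha'.1], by linarith [hc.2, ha'.2]⟩ hν

/-- **Slab 8 on the typed box**: for every parameter vector of `emeryBoxBi2223IPK11Src`, every co-shift `a ∈ [0.4, 0.5]` and every Fermi energy at
which the CO-SHIFTED σ antibonding band holds the box's electrons: `ε ∈ [0.92, 1.88]`, `t′/t ∈ [-0.4709, -0.3647]` (MEETS).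
[folklore] -/
theorem emeryBoxBi2223IPK11Src_axSlab8 :
    HoldsOn (fun p : EmeryCoord → ℝ => ∀ a ε : ℝ, a ∈ Set.Icc (2 / 5 : ℝ) (1 / 2 : ℝ) →
      abFilling (p .DeltaPd) (p .tpd) (p .tpp + a) (p .tppP + a) ε = (2 - p .nHoles) / 2 →
      ε ∈ Set.Icc (23 / 25 : ℝ) (47 / 25 : ℝ) ∧
      fsRatio (p .DeltaPd) (p .tpd) (p .tpp + a) (p .tppP + a) ε ∈ Set.Icc (-(4709 / 10000 : ℝ)) (-(3647 / 10000 : ℝ))) emeryBoxBi2223IPK11Src := by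
  intro p hp a ε ha' hf
  obtain ⟨hΔ, ha, hb, hc, hν⟩ := emeryBoxBi2223IPK11Src_axRows hp
  rw [← hf] at hν
  exact bi2223IPAxSlab8_window hΔ ha ⟨by linarith [hb.1, ha'.1], by linarith [hb.2, ha'.2]⟩
    ⟨by linarith [hc.1, ha'.1], by linarith [hc.2, ha'.2]⟩ hν

/-! ## §3 The census verdicts against the E row -/

/-- **STILL SHORT OF THE E ROW for every co-shift `a ∈ [0, 0.02]`**: the co-shifted σ (= four-orbital at the Fermi level) `t′/t` stays ABOVE
`-0.336` — the one-band Fermi surface of record REQUIRES an axial admixture `a_F > 0.02` eV beyond the box's σ rows. [folklore] -/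
theorem emeryBoxBi2223IPK11Src_axial_short :
    HoldsOn (fun p : EmeryCoord → ℝ => ∀ a ε : ℝ, a ∈ Set.Icc (0 : ℝ) (1 / 50 : ℝ) →
      abFilling (p .DeltaPd) (p .tpd) (p .tpp + a) (p .tppP + a) ε = (2 - p .nHoles) / 2 →
      (-(42 / 125 : ℝ)) < fsRatio (p .DeltaPd) (p .tpd) (p .tpp + a) (p .tppP + a) ε) emeryBoxBi2223IPK11Src := by
  intro p hp a ε ha' hf
  have h := (emeryBoxBi2223IPK11Src_axSlab0 p hp a ε ha' hf).2
  exact lt_of_lt_of_le (by norm_num) h.1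

/-- **INSIDE THE E ROW for every co-shift `a ∈ [0.3, 0.35]`**: the co-shifted `t′/t` lies in `[-0.437, -0.336]`. [folklore] -/
theorem emeryBoxBi2223IPK11Src_axial_inside :
    HoldsOn (fun p : EmeryCoord → ℝ => ∀ a ε : ℝ, a ∈ Set.Icc (3 / 10 : ℝ) (7 / 20 : ℝ) →
      abFilling (p .DeltaPd) (p .tpd) (p .tpp + a) (p .tppP + a) ε = (2 - p .nHoles) / 2 →
      fsRatio (p .DeltaPd) (p .tpd) (p .tpp + a) (p .tppP + a) ε ∈ Set.Icc (-(437 / 1000 : ℝ)) (-(42 / 125 : ℝ))) emeryBoxBi2223IPK11Src := by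
  intro p hp a ε ha' hf
  have h := (emeryBoxBi2223IPK11Src_axSlab6 p hp a ε ha' hf).2
  exact ⟨le_trans (by norm_num) h.1, h.2.trans (by norm_num)⟩

/-! ## §4 The four-orbital reading (transfer theorem `EmeryAxialConductionBand.condFilling_eq_abFilling`) -/

/-- **FOUR-ORBITAL FORM OF THE SHORTFALL.** For every parameter vector of `emeryBoxBi2223IPK11Src`, EVERY axial level `ε_s` and coupling `t_sp`, and every
Fermi energy `ε < ε_s` at which the four-orbital CONDUCTION band (`EmeryBandEigenvalues.band4 … 1`) holds the box's electrons: if the axial admixture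
at the Fermi level `t_sp²/(ε_s − ε)` is at most `0.02` eV, the conduction-band Fermi surface (an exact `t–t′` contour,
`EmeryAxialConductionBand.oneBand_of_band4_one_eq`) has `t′/t > -0.336` — it does NOT reproduce the object-E row. [cite: PavariniEtAl2001, Eqs. (1)–(3), Fig. 3] -/
theorem emeryBoxBi2223IPK11Src_fourOrbital_short :
    HoldsOn (fun p : EmeryCoord → ℝ => ∀ εs tsp ε : ℝ, ε < εs →
      tsp ^ 2 / (εs - ε) ≤ (1 / 50 : ℝ) →
      condFilling (p .DeltaPd) εs (p .tpd) (p .tpp) (p .tppP) tsp ε = (2 - p .nHoles) / 2 →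
      (-(42 / 125 : ℝ)) < fsRatio (p .DeltaPd) (p .tpd) (p .tpp + tsp ^ 2 / (εs - ε)) (p .tppP + tsp ^ 2 / (εs - ε)) ε) emeryBoxBi2223IPK11Src := by
  intro p hp εs tsp ε hε ha hf
  rw [condFilling_eq_abFilling hε] at hf
  exact emeryBoxBi2223IPK11Src_axial_short p hp _ ε ⟨div_nonneg (sq_nonneg _) (sub_pos.mpr hε).le, ha⟩ hf

/-- **FOUR-ORBITAL FORM OF THE MATCH**: axial admixture `t_sp²/(ε_s − ε_F) ∈ [0.3, 0.35]` eV puts the conduction-band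
`t′/t` INSIDE the E row `[-0.437, -0.336]`. [cite: PavariniEtAl2001, Eqs. (1)–(3), Fig. 3] -/
theorem emeryBoxBi2223IPK11Src_fourOrbital_inside :
    HoldsOn (fun p : EmeryCoord → ℝ => ∀ εs tsp ε : ℝ, ε < εs →
      tsp ^ 2 / (εs - ε) ∈ Set.Icc (3 / 10 : ℝ) (7 / 20 : ℝ) →
      condFilling (p .DeltaPd) εs (p .tpd) (p .tpp) (p .tppP) tsp ε = (2 - p .nHoles) / 2 →
      fsRatio (p .DeltaPd) (p .tpd) (p .tpp + tsp ^ 2 / (εs - ε)) (p .tppP + tsp ^ 2 / (εs - ε)) ε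
        ∈ Set.Icc (-(437 / 1000 : ℝ)) (-(42 / 125 : ℝ))) emeryBoxBi2223IPK11Src := by
  intro p hp εs tsp ε hε ha hf
  rw [condFilling_eq_abFilling hε] at hf
  exact emeryBoxBi2223IPK11Src_axial_inside p hp _ ε ha hf

end Summit.Ventures.CertifiedManyBodySolver.Downfold.Emery
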